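import Literature.MathematicalPhysics.QuantumLattice.LatticeGaugeDLRGibbsProofs
import Literature.MathematicalPhysics.QuantumFieldTheory.WilsonFinTorusSliceObservables
import Literature.MathematicalPhysics.QuantumFieldTheory.WilsonFinTorusPartitionComplex
import HarnessLib

/-!
# The periodic lift of the anisotropic `Fin`-torus `L³ × T` to `ℤ⁴`, and the local DLR equations of its
# Wilson state read in a `ℤ⁴` window

Companion of `WilsonFinTorusPartition.lean` / `WilsonFinTorusSliceObservables.lean` (Wilson's lattice gauge theory
on the `Fin`-indexed periodic box `L × L × L × T`, expectation `finTorusExpectation ρ β Φ = ∫ Φ e^{−βS} / Z`) and the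
ANISOTROPIC sibling of `LatticeGaugeDLRGibbsProofs.wilsonExpectation_toTorusObservable_eq` (there: the hypercubic
torus `(ℤ/L)^d` of `ConstructiveQFTWave0`).  Contents (all PROVED; lattice bookkeeping and one measure-theoretic
identity, no estimate):

* `finTorusProjSite L T : ℤ⁴ → FinTorusSite L L L T` — reduction of a `ℤ⁴` site modulo `(L, L, L, T)` (time = the
  last axis), through the tree's site bijection `finTorusSiteEquiv` with `ZMod T × (Fin 3 → ZMod L)`; it intertwines
  `x + e_μ` with the torus shift `FinTorusSite.shift` (`finTorusProjSite_add_single`), is inverted on the torus by the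
  canonical representative `finTorusRepr` (`finTorusProjSite_finTorusRepr`), and is injective on every set of sites of
  coordinate-wise diameter `< L` (space) and `< T` (time) (`finTorusProjSite_injOn`);
* `finTorusLift L T V : LGConfig 4 G` — the `(L,L,L,T)`-periodic lift of a torus link configuration
  (`(finTorusLift V) e = V (proj e)`); `ℤ⁴` plaquette holonomies of the lift are torus plaquette holonomies
  (`plaquetteHolonomyZd_finTorusLift`);
* the lattice bookkeeping of a finite `ℤ⁴` window `Λ` whose plaquette closure injects into the torus (near/far split
  of the torus action, `sum_image_finTorusProjPlaq`, `finTorusPlaquette_piecewise_of_ne`, `finTorusLift_piecewise_apply`);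
* **`finTorusExpectation_finTorusLift_eq_kernel` — the torus Wilson state satisfies the local DLR equations of the
  `ℤ⁴` Wilson specification `ymSpecification ρ β` read through the lift**: for a bounded measurable cylinder observable
  `F` on `ℤ⁴` with support `S₀` and a finite link set `Λ` such that reduction mod `(L,L,L,T)` is injective on the base
  points of `Λ ∪ S₀ ∪ ∂Λ`, `⟨F ∘ lift⟩_{L³×T} = ⟨(γ_Λ F) ∘ lift⟩_{L³×T}` (Georgii 2011 Prop. 2.5 / (1.21) on the finite
  product, i.e. the tree's `integral_exp_mul_eq_integral_exp_mul_condAvg`, after the near part of the torus action is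
  identified with the boundary Wilson action of the lift);
* `abs_finTorusExpectation_sub_le`, `abs_finTorusExpectation_lift_sub_lift_le` — consequently TWO tori `L³ × T₁`,
  `L³ × T₂` into which the window injects give `F ∘ lift` expectations that differ by at most the oscillation of the
  kernel mean `η ↦ γ_Λ(F | η)` over pairs of exteriors (the entry point for Dobrushin-type influence bounds);
* `plaquetteActionObs` — the one-plaquette action density `N − Re tr ρ(U_p)` on `ℤ⁴` as a continuous bounded cylinder
  observable, and its lift (`plaquetteActionObs_finTorusLift`).

HONEST FRAMING: identities for a finite-dimensional compact-group integral; nothing here is an estimate, a statement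
about a mass gap, confinement, or the Yang–Mills problem (Clay).

References: H.-O. Georgii, *Gibbs Measures and Phase Transitions* (2011), Def. 2.9, Prop. 2.5, proof of Thm. 4.17
(4.18); S. Friedli, Y. Velenik, *Statistical Mechanics of Lattice Systems* (2017), Lemma 6.7 and the remark on
periodic boundary conditions before Exercise 6.14; E. Seiler, LNP 159 (1982) Ch. 2; I. Montvay, G. Münster,
*Quantum Fields on a Lattice* (1994) §3.2.2 (3.66).
-/

noncomputable section

open scoped BigOperators
open MeasureTheory Filter Function Finset
open Literature.Probability.LatticeModels Literature.MathematicalPhysics.QuantumLattice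
open Literature.Barriers.QuantumFields

namespace Literature.MathematicalPhysics.QuantumFieldTheory

/-! ### The projection `ℤ⁴ → L³ × T` and the periodic lift -/

section Projection

variable {L T : ℕ} [NeZero L] [NeZero T]

variable (L T) in
/-- **Reduction of a `ℤ⁴` site modulo `(L, L, L, T)`** (time = the last axis), valued in the `Fin`-indexed torus
`FinTorusSite L L L T`: the coordinates are cast to `ZMod L` / `ZMod T` and transported along the tree's site bijection
`finTorusSiteEquiv L T : FinTorusSite L L L T ≃ ZMod T × (Fin 3 → ZMod L)` (the finite lattice with periodic boundary
conditions as `ℤ⁴` modulo its periods). [cite: MontvayMunster1994, §3.2.6 (3.145)] -/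
def finTorusProjSite (x : Fin 4 → ℤ) : FinTorusSite L L L T :=
  (finTorusSiteEquiv L T).symm
    (((x 3 : ℤ) : ZMod T), ![((x 0 : ℤ) : ZMod L), ((x 1 : ℤ) : ZMod L), ((x 2 : ℤ) : ZMod L)])

/-- The projection read in `ZMod T × (Fin 3 → ZMod L)` (sites of the periodic lattice = residues of `ℤ⁴` sites).
[cite: MontvayMunster1994, §3.2.6 (3.145)] -/
theorem finTorusSiteEquiv_finTorusProjSite (x : Fin 4 → ℤ) :
    finTorusSiteEquiv L T (finTorusProjSite L T x) =
      (((x 3 : ℤ) : ZMod T), ![((x 0 : ℤ) : ZMod L), ((x 1 : ℤ) : ZMod L), ((x 2 : ℤ) : ZMod L)]) := by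
  simp [finTorusProjSite]

/-- **The projection intertwines the shifts**: `proj (x + e_μ) = (proj x).shift μ` (nearest neighbours of the periodic
lattice are residues of nearest neighbours of `ℤ⁴`). [cite: MontvayMunster1994, §3.2.6 (3.145)] -/
theorem finTorusProjSite_add_single (x : Fin 4 → ℤ) (μ : Fin 4) :
    finTorusProjSite L T (x + Pi.single μ 1) = (finTorusProjSite L T x).shift μ := by
  apply (finTorusSiteEquiv L T).injective
  rw [finTorusSiteEquiv_shift, finTorusSiteEquiv_finTorusProjSite, finTorusSiteEquiv_finTorusProjSite]
  fin_cases μ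
  · simp [FiniteTemperature.Site.shift, vec3_add_single_zero, -Matrix.cons_add]
  · simp [FiniteTemperature.Site.shift, vec3_add_single_one, -Matrix.cons_add]
  · simp [FiniteTemperature.Site.shift, vec3_add_single_two, -Matrix.cons_add]
  · simp [FiniteTemperature.Site.shift]

/-- The torus shifts are injective. [folklore] -/
private theorem FinTorusSite.shift_injective {n₀ n₁ n₂ n₃ : ℕ} (μ : Fin 4) :
    Function.Injective fun x : FinTorusSite n₀ n₁ n₂ n₃ => x.shift μ := by
  intro a b h
  fin_cases μ <;>
    simpa [FinTorusSite.shift, Prod.ext_iff, (finRotate _).injective.eq_iff] using h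

/-- `proj (x − e_μ)` is the site whose `μ`-shift is `proj x`. [folklore] -/
private theorem finTorusProjSite_sub_single_shift (x : Fin 4 → ℤ) (μ : Fin 4) :
    (finTorusProjSite L T (x - Pi.single μ 1)).shift μ = finTorusProjSite L T x := by
  rw [← finTorusProjSite_add_single, sub_add_cancel]

/-- **Canonical `ℤ⁴` representative** of a torus site: its coordinates read as natural numbers. [cite: MontvayMunster1994, §3.2.6 (3.145)] -/
def finTorusRepr (x : FinTorusSite L L L T) : (Fin 4 → ℤ) :=
  ![((x.1 : ℕ) : ℤ), ((x.2.1 : ℕ) : ℤ), ((x.2.2.1 : ℕ) : ℤ), ((x.2.2.2 : ℕ) : ℤ)]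

/-- `(k : ZMod n) = ZMod.finEquiv n k` for `k : Fin n` (both are `k` once `n = m + 1`). [folklore] -/
private theorem natCast_val_eq_finEquiv {n : ℕ} [NeZero n] (k : Fin n) : ((k : ℕ) : ZMod n) = ZMod.finEquiv n k := by
  cases n with
  | zero => exact absurd rfl (NeZero.ne 0)
  | succ n => exact Fin.cast_val_eq_self k

/-- **The projection inverts the representative**: `proj (repr x) = x` (every site of the periodic lattice is the
residue of its canonical representative in the fundamental box `[0,L)³ × [0,T)`). [cite: MontvayMunster1994, §3.2.6 (3.145)] -/
@[simp] theorem finTorusProjSite_finTorusRepr (x : FinTorusSite L L L T) :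
    finTorusProjSite L T (finTorusRepr x) = x := by
  apply (finTorusSiteEquiv L T).injective
  rw [finTorusSiteEquiv_finTorusProjSite]
  simp [finTorusRepr, natCast_val_eq_finEquiv, finTorusSiteEquiv]

/-- **Injectivity on small sets**: reduction mod `(L,L,L,T)` is injective on every set of sites whose spatial
coordinates differ by `< L` and whose time coordinates differ by `< T` (a box smaller than the periods embeds in the
periodic lattice). [cite: MontvayMunster1994, §3.2.6 (3.145)] -/
theorem finTorusProjSite_injOn {B : Set (Fin 4 → ℤ)}
    (hB : ∀ x ∈ B, ∀ y ∈ B, |x 0 - y 0| < L ∧ |x 1 - y 1| < L ∧ |x 2 - y 2| < L ∧ |x 3 - y 3| < T) :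
    Set.InjOn (finTorusProjSite L T) B := by
  intro x hx y hy hxy
  have h := congrArg (finTorusSiteEquiv L T) hxy
  rw [finTorusSiteEquiv_finTorusProjSite, finTorusSiteEquiv_finTorusProjSite, Prod.mk.injEq] at h
  obtain ⟨h3, hv⟩ := h
  have h0 := congr_fun hv 0
  have h1 := congr_fun hv 1
  have h2 := congr_fun hv 2
  simp only [Matrix.cons_val_zero, Matrix.cons_val_one, Matrix.cons_val_two, Matrix.head_cons,
    Matrix.tail_cons] at h0 h1 h2
  have key : ∀ {n : ℕ} {a b : ℤ}, ((a : ℤ) : ZMod n) = ((b : ℤ) : ZMod n) → |a - b| < n → a = b := by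
    intro n a b hab hlt
    rw [ZMod.intCast_eq_intCast_iff_dvd_sub] at hab
    have : b - a = 0 := Int.eq_zero_of_abs_lt_dvd hab (by rw [abs_sub_comm]; exact hlt)
    omega
  obtain ⟨b0, b1, b2, b3⟩ := hB x hx y hy
  funext k
  fin_cases k
  · exact key h0 b0
  · exact key h1 b1
  · exact key h2 b2
  · exact key h3 b3

variable (L T) in
/-- Reduction of a `ℤ⁴` link to a torus link: reduce the base point. [cite: MontvayMunster1994, §3.2.6 (3.145)] -/
def finTorusProjEdge (e : ZdEdge 4) : FinTorusSite L L L T × Fin 4 :=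
  (finTorusProjSite L T e.1, e.2)

variable (L T) in
/-- Reduction of a `ℤ⁴` plaquette to a torus plaquette: reduce the base point. [cite: MontvayMunster1994, §3.2.6 (3.145)] -/
def finTorusProjPlaq (p : ZdPlaquette 4) : FinTorusSite L L L T × {q : Fin 4 × Fin 4 // q.1 < q.2} :=
  (finTorusProjSite L T p.1, p.2)

variable (L T) in
/-- **The periodic lift** of a torus link configuration to `ℤ⁴`: `(finTorusLift V) e = V (proj e)` — the periodic
extension of a configuration of the lattice with periodic boundary conditions. [cite: MontvayMunster1994, §3.2.6 (3.145)] -/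
def finTorusLift {G : Type*} (V : FinTorusSite L L L T × Fin 4 → G) : LGConfig 4 G :=
  fun e => V (finTorusProjEdge L T e)

/-- Unfolding of the lift: the lifted configuration is the periodic extension `U(b) = V(b mod periods)`.
[cite: MontvayMunster1994, §3.2.6 (3.145)] -/
@[simp] theorem finTorusLift_apply {G : Type*} (V : FinTorusSite L L L T × Fin 4 → G) (e : ZdEdge 4) :
    finTorusLift L T V e = V (finTorusProjSite L T e.1, e.2) :=
  rfl

/-- The lift is continuous (coordinate projections). [cite: MontvayMunster1994, §3.2.6 (3.145)] -/
theorem continuous_finTorusLift {G : Type*} [TopologicalSpace G] :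
    Continuous (finTorusLift L T : (FinTorusSite L L L T × Fin 4 → G) → LGConfig 4 G) :=
  continuous_pi fun _ => continuous_apply _

/-- The lift is measurable (coordinate projections). [cite: MontvayMunster1994, §3.2.6 (3.145)] -/
theorem measurable_finTorusLift {G : Type*} [MeasurableSpace G] :
    Measurable (finTorusLift L T : (FinTorusSite L L L T × Fin 4 → G) → LGConfig 4 G) :=
  measurable_pi_iff.2 fun _ => measurable_pi_apply _

/-- **Holonomies are compatible with the lift**: the `ℤ⁴` plaquette holonomy of the lifted configuration at `x` is the
torus plaquette holonomy at `proj x` (the plaquette variables of the periodic lattice).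
[cite: MontvayMunster1994, §3.2.2 (3.64) and §3.2.6 (3.145)] -/
theorem plaquetteHolonomyZd_finTorusLift {G : Type*} [Group G] (V : FinTorusSite L L L T × Fin 4 → G) (x : Fin 4 → ℤ)
    (i j : Fin 4) :
    plaquetteHolonomyZd (finTorusLift L T V) x i j = finTorusPlaquette V (finTorusProjSite L T x) i j := by
  simp only [plaquetteHolonomyZd, finTorusPlaquette, finTorusLift_apply, finTorusProjSite_add_single]

end Projection

/-! ### Lattice bookkeeping of a window whose plaquette closure injects into the torus -/

section Lattice

variable {L T : ℕ} [NeZero L] [NeZero T]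

/-- `finTorusProjEdge` is injective on a finite link set as soon as `finTorusProjSite` is injective on its base points.
[folklore] -/
private theorem injOn_finTorusProjEdge {S : Finset (ZdEdge 4)}
    (hL : Set.InjOn (finTorusProjSite L T) (S.image Prod.fst : Set (Fin 4 → ℤ))) :
    Set.InjOn (finTorusProjEdge L T) ↑S := by
  intro e₁ h₁ e₂ h₂ h
  simp only [finTorusProjEdge, Prod.mk.injEq] at h
  refine Prod.ext (hL ?_ ?_ h.1) h.2
  · exact mem_coe.2 (mem_image_of_mem _ h₁)
  · exact mem_coe.2 (mem_image_of_mem _ h₂)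

/-- A torus plaquette `q = (y, i, j)` one of whose four links `(y, i), (y + eᵢ, j), (y + eⱼ, i), (y, j)` is the
projection of a link `e ∈ Λ` is the projection of a `ℤ⁴` plaquette touching `Λ`. [folklore] -/
private theorem exists_finTorusProjPlaq_eq {Λ : Finset (ZdEdge 4)} {e : ZdEdge 4} (he : e ∈ Λ)
    (q : FinTorusSite L L L T × {q : Fin 4 × Fin 4 // q.1 < q.2})
    (hq : finTorusProjEdge L T e = (q.1, q.2.1.1) ∨ finTorusProjEdge L T e = (q.1.shift q.2.1.1, q.2.1.2) ∨
      finTorusProjEdge L T e = (q.1.shift q.2.1.2, q.2.1.1) ∨ finTorusProjEdge L T e = (q.1, q.2.1.2)) :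
    ∃ p ∈ plaquettesTouching Λ, finTorusProjPlaq L T p = q := by
  obtain ⟨x, k⟩ := e
  obtain ⟨y, ij⟩ := q
  simp only [finTorusProjEdge, Prod.mk.injEq] at hq
  rcases hq with ⟨h1, h2⟩ | ⟨h1, h2⟩ | ⟨h1, h2⟩ | ⟨h1, h2⟩
  · refine ⟨(x, ij), mem_plaquettesTouching_iff.2 ⟨(x, k), mem_inter.2 ⟨?_, he⟩⟩, ?_⟩
    · simp [plaquetteEdges, h2]
    · simp [finTorusProjPlaq, h1]
  · refine ⟨(x - Pi.single ij.1.1 1, ij),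
      mem_plaquettesTouching_iff.2 ⟨(x, k), mem_inter.2 ⟨?_, he⟩⟩, ?_⟩
    · simp [plaquetteEdges, h2]
    · simp only [finTorusProjPlaq, Prod.mk.injEq, and_true]
      exact FinTorusSite.shift_injective ij.1.1 (by simp only [finTorusProjSite_sub_single_shift, h1])
  · refine ⟨(x - Pi.single ij.1.2 1, ij),
      mem_plaquettesTouching_iff.2 ⟨(x, k), mem_inter.2 ⟨?_, he⟩⟩, ?_⟩
    · simp [plaquetteEdges, h2]
    · simp only [finTorusProjPlaq, Prod.mk.injEq, and_true]
      exact FinTorusSite.shift_injective ij.1.2 (by simp only [finTorusProjSite_sub_single_shift, h1])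
  · refine ⟨(x, ij), mem_plaquettesTouching_iff.2 ⟨(x, k), mem_inter.2 ⟨?_, he⟩⟩, ?_⟩
    · simp [plaquetteEdges, h2]
    · simp [finTorusProjPlaq, h1]

/-- Projection to the torus is injective on the plaquettes touching `Λ` once `finTorusProjSite` is injective on the
base points of their links. [folklore] -/
private theorem injOn_finTorusProjPlaq {Λ : Finset (ZdEdge 4)} {B : Finset (Fin 4 → ℤ)}
    (hB : ((plaquettesTouching Λ).biUnion plaquetteEdges).image Prod.fst ⊆ B)
    (hL : Set.InjOn (finTorusProjSite L T) (B : Set (Fin 4 → ℤ))) :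
    Set.InjOn (finTorusProjPlaq L T) ↑(plaquettesTouching Λ) := by
  intro p₁ h₁ p₂ h₂ h
  simp only [finTorusProjPlaq, Prod.mk.injEq] at h
  refine Prod.ext (hL ?_ ?_ h.1) h.2
  · exact hB (fst_mem_image_of_mem_plaquettesTouching h₁)
  · exact hB (fst_mem_image_of_mem_plaquettesTouching h₂)

variable {G : Type*} [Group G] {N : ℕ} (ρ : G →* Matrix (Fin N) (Fin N) ℂ)

/-- **Near part of the torus action.**  The torus plaquette terms `N − Re tr ρ(V_q)` over the projections `q` of the
`ℤ⁴` plaquettes touching `Λ` sum to the boundary Wilson action `S_Λ` of the lifted configuration. [folklore] -/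
private theorem sum_image_finTorusProjPlaq {Λ : Finset (ZdEdge 4)}
    (hinj : Set.InjOn (finTorusProjPlaq L T) ↑(plaquettesTouching Λ)) (V : FinTorusSite L L L T × Fin 4 → G) :
    ∑ q ∈ (plaquettesTouching Λ).image (finTorusProjPlaq L T),
        ((N : ℝ) - (ρ (finTorusPlaquette V q.1 q.2.1.1 q.2.1.2)).trace.re) =
      wilsonBoundaryAction ρ Λ (finTorusLift L T V) := by
  classical
  rw [sum_image hinj, wilsonBoundaryAction]
  refine sum_congr rfl fun p _ => ?_
  simp only [plaquetteObs, plaquetteHolonomyZd_finTorusLift, finTorusProjPlaq]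

/-- **Far part of the torus action.**  A torus plaquette that is not the projection of a `ℤ⁴` plaquette touching `Λ`
has no link in `Λ.image proj`, so its holonomy is unchanged when the links in `Λ.image proj` are resampled. [folklore] -/
private theorem finTorusPlaquette_piecewise_of_ne {Λ : Finset (ZdEdge 4)}
    {q : FinTorusSite L L L T × {q : Fin 4 × Fin 4 // q.1 < q.2}}
    (hq : ∀ p ∈ plaquettesTouching Λ, finTorusProjPlaq L T p ≠ q) (W V : FinTorusSite L L L T × Fin 4 → G) :
    finTorusPlaquette ((Λ.image (finTorusProjEdge L T)).piecewise W V) q.1 q.2.1.1 q.2.1.2 =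
      finTorusPlaquette V q.1 q.2.1.1 q.2.1.2 := by
  classical
  have key : ∀ e' : FinTorusSite L L L T × Fin 4,
      (e' = (q.1, q.2.1.1) ∨ e' = (q.1.shift q.2.1.1, q.2.1.2) ∨ e' = (q.1.shift q.2.1.2, q.2.1.1) ∨
        e' = (q.1, q.2.1.2)) →
      (Λ.image (finTorusProjEdge L T)).piecewise W V e' = V e' := fun e' h' =>
    piecewise_eq_of_notMem _ _ _ fun hmem => by
      obtain ⟨e, he, rfl⟩ := mem_image.1 hmem
      obtain ⟨p, hp, hpq⟩ := exists_finTorusProjPlaq_eq he q h'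
      exact hq p hp hpq
  simp only [finTorusPlaquette]
  rw [key _ (Or.inl rfl), key _ (Or.inr (Or.inl rfl)), key _ (Or.inr (Or.inr (Or.inl rfl))),
    key _ (Or.inr (Or.inr (Or.inr rfl)))]

omit [Group G] in
/-- **Lift of a resampled torus configuration.**  On a link set `S ⊇ Λ` on which `finTorusProjEdge` is injective,
lifting the torus configuration whose links in `Λ.image proj` are taken from `W` agrees with gluing `W ∘ proj` on `Λ`
into the lift of `V`. [folklore] -/
private theorem finTorusLift_piecewise_apply {Λ S : Finset (ZdEdge 4)} (hΛS : Λ ⊆ S)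
    (hinj : Set.InjOn (finTorusProjEdge L T) ↑S) (W V : FinTorusSite L L L T × Fin 4 → G)
    {e : ZdEdge 4} (he : e ∈ S) :
    finTorusLift L T ((Λ.image (finTorusProjEdge L T)).piecewise W V) e =
      glueWith Λ (fun e' : ↥Λ => W (finTorusProjEdge L T e')) (finTorusLift L T V) e := by
  classical
  change ((Λ.image (finTorusProjEdge L T)).piecewise W V) (finTorusProjEdge L T e) = _
  by_cases heΛ : e ∈ Λ
  · rw [piecewise_eq_of_mem _ _ _ (mem_image_of_mem _ heΛ), glueWith_apply_mem _ _ _ heΛ]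
  · rw [glueWith_apply_not_mem _ _ _ heΛ, piecewise_eq_of_notMem]
    · rfl
    · intro hmem
      obtain ⟨e'', he'', h⟩ := mem_image.1 hmem
      exact heΛ (hinj (hΛS he'') he h ▸ he'')

omit [NeZero L] [NeZero T] in
/-- The torus plaquette terms `N − Re tr ρ(U_p)` are continuous in the link configuration (continuous `ρ`).
[cite: MontvayMunster1994, §3.2.2 (3.65)–(3.67)] -/
theorem continuous_finTorusPlaquetteTerm [TopologicalSpace G] [IsTopologicalGroup G] (hρ : Continuous ρ)
    (q : FinTorusSite L L L T × {q : Fin 4 × Fin 4 // q.1 < q.2}) :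
    Continuous fun V : FinTorusSite L L L T × Fin 4 → G =>
      (N : ℝ) - (ρ (finTorusPlaquette V q.1 q.2.1.1 q.2.1.2)).trace.re := by
  have h : Continuous fun V : FinTorusSite L L L T × Fin 4 → G => finTorusPlaquette V q.1 q.2.1.1 q.2.1.2 := by
    unfold finTorusPlaquette; fun_prop
  exact continuous_const.sub (Complex.continuous_re.comp ((hρ.comp h).matrix_trace))

end Lattice

/-! ### The torus Wilson state satisfies the local DLR equations of `ymSpecification`, read through the lift -/

section DLR

variable {L T : ℕ} [NeZero L] [NeZero T] {G : Type*} [Group G] [TopologicalSpace G] [IsTopologicalGroup G]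
  [CompactSpace G] [MeasurableSpace G] [BorelSpace G] [SecondCountableTopology G] {N : ℕ}
  (ρ : G →* Matrix (Fin N) (Fin N) ℂ)

/-- **Local DLR equations of the anisotropic torus state, read in a `ℤ⁴` window.**  Let `F` be a bounded measurable
cylinder observable on `ℤ⁴` with support `S₀`, `Λ` a finite link set, and let reduction mod `(L,L,L,T)` be injective on
the base points of `Λ ∪ S₀ ∪ ∂Λ` (`∂Λ` = links of the plaquettes touching `Λ`).  Then the Wilson state of the torus
`L³ × T` gives the same expectation to `F ∘ lift` and to `(γ_Λ F) ∘ lift`, `γ = ymSpecification ρ β` the `ℤ⁴` Wilson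
specification: `⟨F ∘ lift⟩ = ⟨(∫ F dγ_Λ(·|·)) ∘ lift⟩`.  (Near/far split of the torus action: the near part is the
boundary Wilson action of the lift, the far part does not feel the links over `Λ`; then Georgii's finite-product DLR
identity `integral_exp_mul_eq_integral_exp_mul_condAvg`.)
[cite: Georgii2011, Prop. 2.5 and proof of Thm. 4.17 (4.18)] -/
theorem finTorusExpectation_finTorusLift_eq_kernel (hρ : Continuous ρ) (β : ℝ) (Λ : Finset (ZdEdge 4))
    {F : LGConfig 4 G → ℝ} (hF : Measurable F) {C : ℝ} (hC : ∀ U, |F U| ≤ C)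
    {S₀ : Finset (ZdEdge 4)} (hFS : IsCylinder F S₀)
    (hL : Set.InjOn (finTorusProjSite L T)
      ((Λ ∪ S₀ ∪ (plaquettesTouching Λ).biUnion plaquetteEdges).image Prod.fst : Set (Fin 4 → ℤ))) :
    finTorusExpectation ρ β (fun V : FinTorusSite L L L T × Fin 4 → G => F (finTorusLift L T V)) =
      finTorusExpectation ρ β (fun V : FinTorusSite L L L T × Fin 4 → G =>
        ∫ U, F U ∂(ymSpecification ρ β Λ (finTorusLift L T V))) := by
  classical
  -- the relevant finite link set `S` and the injectivity consequences of `hL`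
  have hΛS : Λ ⊆ Λ ∪ S₀ ∪ (plaquettesTouching Λ).biUnion plaquetteEdges :=
    (subset_union_left).trans subset_union_left
  have hS₀S : S₀ ⊆ Λ ∪ S₀ ∪ (plaquettesTouching Λ).biUnion plaquetteEdges :=
    (subset_union_right).trans subset_union_left
  have hPS : (plaquettesTouching Λ).biUnion plaquetteEdges ⊆
      Λ ∪ S₀ ∪ (plaquettesTouching Λ).biUnion plaquetteEdges := subset_union_right
  have hSinj := injOn_finTorusProjEdge hL
  have hPinj := injOn_finTorusProjPlaq (image_subset_image hPS) hL
  -- near and far parts of the torus action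
  set a : (FinTorusSite L L L T × Fin 4 → G) → ℝ := fun V =>
    -β * ∑ q ∈ (plaquettesTouching Λ).image (finTorusProjPlaq L T),
      ((N : ℝ) - (ρ (finTorusPlaquette V q.1 q.2.1.1 q.2.1.2)).trace.re) with ha_def
  set b : (FinTorusSite L L L T × Fin 4 → G) → ℝ := fun V =>
    -β * ∑ q ∈ ((plaquettesTouching Λ).image (finTorusProjPlaq L T))ᶜ,
      ((N : ℝ) - (ρ (finTorusPlaquette V q.1 q.2.1.1 q.2.1.2)).trace.re) with hb_def
  have hab : ∀ V : FinTorusSite L L L T × Fin 4 → G, finTorusTwistedWeight ρ β 1 V = Real.exp (a V + b V) := by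
    intro V
    rw [finTorusTwistedWeight_one]
    congr 1
    simp only [ha_def, hb_def, ← mul_add, Finset.sum_add_sum_compl]
    congr 1
    exact (Fintype.sum_prod_type fun i : FinTorusSite L L L T × {q : Fin 4 × Fin 4 // q.1 < q.2} =>
      ((N : ℝ) - (ρ (finTorusPlaquette V i.1 i.2.1.1 i.2.1.2)).trace.re)).symm
  have ha : ∀ V, a V = -β * wilsonBoundaryAction ρ Λ (finTorusLift L T V) := fun V => by
    simp only [ha_def, sum_image_finTorusProjPlaq ρ hPinj]
  have hb : ∀ W V, b ((Λ.image (finTorusProjEdge L T)).piecewise W V) = b V := fun W V => by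
    simp only [hb_def]
    congr 1
    refine Finset.sum_congr rfl fun q hq => ?_
    rw [finTorusPlaquette_piecewise_of_ne (fun p hp h => (Finset.mem_compl.1 hq)
      (Finset.mem_image.2 ⟨p, hp, h⟩)) W V]
  have hac : Continuous a :=
    continuous_const.mul (continuous_finsetSum _ fun q _ => continuous_finTorusPlaquetteTerm ρ hρ q)
  have hbc : Continuous b :=
    continuous_const.mul (continuous_finsetSum _ fun q _ => continuous_finTorusPlaquetteTerm ρ hρ q)
  obtain ⟨A, hA⟩ := exists_bound_of_continuous hac
  obtain ⟨B, hB⟩ := exists_bound_of_continuous hbc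
  have hFt : Measurable fun V : FinTorusSite L L L T × Fin 4 → G => F (finTorusLift L T V) :=
    hF.comp measurable_finTorusLift
  -- transfer of the fibre integrals from `G^Λ` to the torus
  have hτ : Function.Injective fun e : ↥Λ => finTorusProjEdge L T (e : ZdEdge 4) := fun e₁ e₂ h =>
    Subtype.ext (hSinj (hΛS e₁.2) (hΛS e₂.2) h)
  have transfer : ∀ Φ : LGConfig 4 G → ℝ, Measurable Φ →
      DependsOn Φ ↑(Λ ∪ S₀ ∪ (plaquettesTouching Λ).biUnion plaquetteEdges) →
      ∀ V : FinTorusSite L L L T × Fin 4 → G,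
        ∫ ζ, Φ (glueWith Λ ζ (finTorusLift L T V)) ∂(Measure.pi fun _ : ↥Λ => haarProbability G) =
          ∫ W, Φ (finTorusLift L T ((Λ.image (finTorusProjEdge L T)).piecewise W V))
            ∂(Measure.pi fun _ : FinTorusSite L L L T × Fin 4 => haarProbability G) := by
    intro Φ hΦm hΦS V
    have hm : Measurable fun (W : FinTorusSite L L L T × Fin 4 → G) (e : ↥Λ) =>
        W (finTorusProjEdge L T (e : ZdEdge 4)) :=
      measurable_pi_iff.2 fun e => measurable_pi_apply _
    have hmeas : Measurable fun ζ : ↥Λ → G => Φ (glueWith Λ ζ (finTorusLift L T V)) :=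
      hΦm.comp (measurable_glueWith Λ _)
    rw [← pi_map_comp_injective (haarProbability G) hτ, integral_map hm.aemeasurable hmeas.aestronglyMeasurable]
    refine congrArg _ (funext fun W => hΦS fun e he => ?_)
    exact (finTorusLift_piecewise_apply hΛS hSinj W V he).symm
  -- locality of the two fibre integrands
  have hSS : DependsOn (wilsonBoundaryAction (G := G) ρ Λ) ↑(Λ ∪ S₀ ∪ (plaquettesTouching Λ).biUnion plaquetteEdges) :=
    (isCylinder_wilsonBoundaryAction_holds (G := G) ρ Λ).mono (Finset.coe_subset.2 hPS)
  have hFS' : DependsOn F ↑(Λ ∪ S₀ ∪ (plaquettesTouching Λ).biUnion plaquetteEdges) :=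
    hFS.mono (Finset.coe_subset.2 hS₀S)
  have hw : Continuous fun U : LGConfig 4 G => Real.exp (-β * wilsonBoundaryAction ρ Λ U) :=
    Real.continuous_exp.comp (continuous_const.mul (continuous_wilsonBoundaryAction ρ hρ Λ))
  -- the kernel mean of `F` at a periodic exterior, computed on the torus
  have key : ∀ V : FinTorusSite L L L T × Fin 4 → G,
      ∫ U, F U ∂(ymSpecification ρ β Λ (finTorusLift L T V)) =
        (∫ W, F (finTorusLift L T ((Λ.image (finTorusProjEdge L T)).piecewise W V)) *
            Real.exp (a ((Λ.image (finTorusProjEdge L T)).piecewise W V))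
            ∂(Measure.pi fun _ : FinTorusSite L L L T × Fin 4 => haarProbability G)) /
          ∫ W, Real.exp (a ((Λ.image (finTorusProjEdge L T)).piecewise W V))
            ∂(Measure.pi fun _ : FinTorusSite L L L T × Fin 4 => haarProbability G) := by
    intro V
    rw [integral_ymSpecification ρ hρ β Λ hF,
      transfer (fun U => F U * Real.exp (-β * wilsonBoundaryAction ρ Λ U)) (hF.mul hw.measurable)
        (fun x y h => by simp only [hFS' h, hSS h]),
      transfer (fun U => Real.exp (-β * wilsonBoundaryAction ρ Λ U)) hw.measurable
        (fun x y h => by simp only [hSS h])]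
    simp only [ha]
  -- conclude with the finite-volume DLR identity on the torus
  rw [finTorusExpectation_eq_div, finTorusExpectation_eq_div]
  congr 1
  simp only [key, hab]
  have e1 : (fun V : FinTorusSite L L L T × Fin 4 → G => F (finTorusLift L T V) * Real.exp (a V + b V)) =
      fun V => Real.exp (a V + b V) * F (finTorusLift L T V) := funext fun V => mul_comm _ _
  have e2 : (fun V : FinTorusSite L L L T × Fin 4 → G =>
      (∫ W, F (finTorusLift L T ((Λ.image (finTorusProjEdge L T)).piecewise W V)) *
            Real.exp (a ((Λ.image (finTorusProjEdge L T)).piecewise W V))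
            ∂(Measure.pi fun _ : FinTorusSite L L L T × Fin 4 => haarProbability G)) /
          (∫ W, Real.exp (a ((Λ.image (finTorusProjEdge L T)).piecewise W V))
            ∂(Measure.pi fun _ : FinTorusSite L L L T × Fin 4 => haarProbability G)) *
        Real.exp (a V + b V)) =
      fun V => Real.exp (a V + b V) *
        ((∫ W, F (finTorusLift L T ((Λ.image (finTorusProjEdge L T)).piecewise W V)) *
            Real.exp (a ((Λ.image (finTorusProjEdge L T)).piecewise W V))
            ∂(Measure.pi fun _ : FinTorusSite L L L T × Fin 4 => haarProbability G)) /
          ∫ W, Real.exp (a ((Λ.image (finTorusProjEdge L T)).piecewise W V))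
            ∂(Measure.pi fun _ : FinTorusSite L L L T × Fin 4 => haarProbability G)) :=
    funext fun V => mul_comm _ _
  rw [e1, e2]
  exact integral_exp_mul_eq_integral_exp_mul_condAvg (haarProbability G)
    (Λ.image (finTorusProjEdge L T)) (F := fun V => F (finTorusLift L T V))
    (NF := fun V => ∫ W, F (finTorusLift L T ((Λ.image (finTorusProjEdge L T)).piecewise W V)) *
      Real.exp (a ((Λ.image (finTorusProjEdge L T)).piecewise W V))
        ∂(Measure.pi fun _ : FinTorusSite L L L T × Fin 4 => haarProbability G))
    (N1 := fun V => ∫ W, Real.exp (a ((Λ.image (finTorusProjEdge L T)).piecewise W V))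
        ∂(Measure.pi fun _ : FinTorusSite L L L T × Fin 4 => haarProbability G))
    hFt hac.measurable hbc.measurable (fun V => hC _) hA hB hb (fun V => rfl) (fun V => rfl)

/-! ### Expectations: averaging bounds, and the two-torus comparison -/

omit [NeZero L] [NeZero T] in
/-- **Averaging bound**: if `|Φ U − c| ≤ ε` for every configuration `U` (`Φ` measurable), then `|⟨Φ⟩ − c| ≤ ε` —
the torus expectation is an average against a probability measure. [cite: MontvayMunster1994, §3.2.2 (3.66)] -/
theorem abs_finTorusExpectation_sub_le (hρ : Continuous ρ) (β : ℝ)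
    {Φ : (FinTorusSite L L L T × Fin 4 → G) → ℝ} (hΦ : Measurable Φ) {c ε : ℝ} (h : ∀ U, |Φ U - c| ≤ ε) :
    |finTorusExpectation ρ β Φ - c| ≤ ε := by
  set μ : Measure (FinTorusSite L L L T × Fin 4 → G) := Measure.pi fun _ => haarProbability G with hμ
  set w : (FinTorusSite L L L T × Fin 4 → G) → ℝ := finTorusTwistedWeight ρ β 1 with hw
  have hwc : Continuous w := continuous_finTorusTwistedWeight ρ hρ β 1
  have hwpos : ∀ U, 0 < w U := fun U => finTorusTwistedWeight_pos ρ β 1 U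
  have hZ : wilsonFinTorusPartition ρ β L L L T = ∫ U, w U ∂μ :=
    wilsonFinTorusPartition_eq_integral_finTorusTwistedWeight_one ρ β L L L T
  have hZpos : 0 < wilsonFinTorusPartition ρ β L L L T := wilsonFinTorusPartition_pos hρ β L L L T
  have hε : 0 ≤ ε := (abs_nonneg _).trans (h fun _ => 1)
  obtain ⟨Cw, hCw⟩ := exists_bound_of_continuous hwc
  have hwi : Integrable w μ := integrable_of_bound hwc.aestronglyMeasurable hCw
  have hbd : ∀ U, |(Φ U - c) * w U| ≤ ε * Cw := fun U => by
    rw [abs_mul]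
    exact mul_le_mul (h U) (hCw U) (abs_nonneg _) hε
  have hgi : Integrable (fun U => (Φ U - c) * w U) μ :=
    integrable_of_bound ((hΦ.sub_const c).mul hwc.measurable).aestronglyMeasurable hbd
  have hsplit : finTorusExpectation ρ β Φ - c = (∫ U, (Φ U - c) * w U ∂μ) / wilsonFinTorusPartition ρ β L L L T := by
    rw [finTorusExpectation_eq_div, eq_div_iff hZpos.ne', sub_mul, div_mul_cancel₀ _ hZpos.ne', hZ,
      ← integral_const_mul, ← integral_sub]
    · refine integral_congr_ae (ae_of_all _ fun U => ?_)
      simp only [hw]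
      ring
    · have : (fun U => Φ U * finTorusTwistedWeight ρ β 1 U) = fun U => (Φ U - c) * w U + c * w U := by
        funext U; simp only [hw]; ring
      rw [this]
      exact hgi.add (hwi.const_mul c)
    · exact hwi.const_mul c
  rw [hsplit, abs_div, abs_of_pos hZpos, div_le_iff₀ hZpos, hZ]
  calc |∫ U, (Φ U - c) * w U ∂μ| ≤ ∫ U, |(Φ U - c) * w U| ∂μ := abs_integral_le_integral_abs
    _ ≤ ∫ U, ε * w U ∂μ := by
        refine integral_mono hgi.abs (hwi.const_mul ε) fun U => ?_
        simp only [abs_mul, abs_of_pos (hwpos U)]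
        exact mul_le_mul_of_nonneg_right (h U) (hwpos U).le
    _ = ε * ∫ U, w U ∂μ := integral_const_mul _ _

/-- **Two-torus comparison through a common window.**  Let `F` be a bounded continuous cylinder observable on `ℤ⁴`
with support `S₀`, `Λ` a finite link set, and let the base points of `Λ ∪ S₀ ∪ ∂Λ` inject into BOTH tori `L³ × T₁` and
`L³ × T₂`.  If the kernel mean `η ↦ ∫ F dγ_Λ(·|η)` oscillates by at most `ε` over pairs of exteriors, then the two torus
expectations of `F ∘ lift` differ by at most `ε`. [cite: Georgii2011, Prop. 2.5 and proof of Thm. 4.17 (4.18)] -/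
theorem abs_finTorusExpectation_lift_sub_lift_le (hρ : Continuous ρ) (β : ℝ) (Λ : Finset (ZdEdge 4))
    {F : LGConfig 4 G → ℝ} (hF : Continuous F) {C : ℝ} (hC : ∀ U, |F U| ≤ C)
    {S₀ : Finset (ZdEdge 4)} (hFS : IsCylinder F S₀) {T₁ T₂ : ℕ} [NeZero T₁] [NeZero T₂]
    (h₁ : Set.InjOn (finTorusProjSite L T₁)
      ((Λ ∪ S₀ ∪ (plaquettesTouching Λ).biUnion plaquetteEdges).image Prod.fst : Set (Fin 4 → ℤ)))
    (h₂ : Set.InjOn (finTorusProjSite L T₂)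
      ((Λ ∪ S₀ ∪ (plaquettesTouching Λ).biUnion plaquetteEdges).image Prod.fst : Set (Fin 4 → ℤ)))
    {ε : ℝ} (hε : ∀ ω η : LGConfig 4 G,
      |(∫ U, F U ∂(ymSpecification ρ β Λ ω)) - ∫ U, F U ∂(ymSpecification ρ β Λ η)| ≤ ε) :
    |finTorusExpectation ρ β (fun V : FinTorusSite L L L T₁ × Fin 4 → G => F (finTorusLift L T₁ V)) -
        finTorusExpectation ρ β (fun V : FinTorusSite L L L T₂ × Fin 4 → G => F (finTorusLift L T₂ V))| ≤ ε := by
  have hγc : Continuous fun η : LGConfig 4 G => ∫ U, F U ∂(ymSpecification ρ β Λ η) :=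
    continuous_integral_ymSpecification ρ hρ β Λ hF hC
  rw [finTorusExpectation_finTorusLift_eq_kernel ρ hρ β Λ hF.measurable hC hFS h₁,
    finTorusExpectation_finTorusLift_eq_kernel ρ hρ β Λ hF.measurable hC hFS h₂]
  refine abs_finTorusExpectation_sub_le ρ hρ β (hγc.measurable.comp measurable_finTorusLift) fun U => ?_
  rw [abs_sub_comm]
  exact abs_finTorusExpectation_sub_le ρ hρ β (hγc.measurable.comp measurable_finTorusLift) fun U' => hε _ _

end DLR

/-! ### The one-plaquette action density as a `ℤ⁴` cylinder observable -/

section Plaquette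

variable {G : Type*} [Group G] {N : ℕ} (ρ : G →* Matrix (Fin N) (Fin N) ℂ)

/-- The one-plaquette Wilson action density `N − Re tr ρ(U_p)` of the `ℤ⁴` plaquette `p` (Montvay–Münster's plaquette
term `S_p` in the tree's normalisation), as an observable on `ℤ⁴` configurations.
[cite: MontvayMunster1994, §3.2.2 (3.65)–(3.67)] -/
def plaquetteActionObs (p : ZdPlaquette 4) (U : LGConfig 4 G) : ℝ :=
  (N : ℝ) - plaquetteObs ρ p.1 p.2.1.1 p.2.1.2 U

/-- The action density is a cylinder observable supported on the four links of its plaquette.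
[cite: MontvayMunster1994, §3.2.2 (3.62)–(3.65)] -/
theorem isCylinder_plaquetteActionObs (p : ZdPlaquette 4) :
    IsCylinder (plaquetteActionObs (G := G) ρ p) (plaquetteEdges p) := fun U V h => by
  simp only [plaquetteActionObs, isCylinder_plaquetteObs ρ p h]

/-- The action density is continuous (continuous `ρ`). [cite: MontvayMunster1994, §3.2.2 (3.65)–(3.67)] -/
theorem continuous_plaquetteActionObs [TopologicalSpace G] [IsTopologicalGroup G] (hρ : Continuous ρ)
    (p : ZdPlaquette 4) : Continuous (plaquetteActionObs (G := G) ρ p) :=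
  continuous_const.sub (continuous_plaquetteObs ρ hρ _ _ _)

/-- `|(N − Re tr ρ(U_p)) − N| ≤ N` for unitary `ρ` (the centred action density is bounded by `N`: `|Re tr U| ≤ N` for
unitary `U`). [cite: MontvayMunster1994, §3.2.2 (3.66)–(3.67)] -/
theorem abs_plaquetteActionObs_sub_le (hρu : ∀ g, ρ g ∈ Matrix.unitaryGroup (Fin N) ℂ) (p : ZdPlaquette 4)
    (U : LGConfig 4 G) : |plaquetteActionObs ρ p U - N| ≤ N := by
  rw [plaquetteActionObs, sub_sub_cancel_left, abs_neg]
  exact abs_plaquetteObs_le_holds ρ hρu _ _ _ U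

/-- `0 ≤ S_p ≤ 2N`-type bound: `|N − Re tr ρ(U_p)| ≤ 2N` for unitary `ρ`. [cite: MontvayMunster1994, §3.2.2 (3.66)–(3.67)] -/
theorem abs_plaquetteActionObs_le (hρu : ∀ g, ρ g ∈ Matrix.unitaryGroup (Fin N) ℂ) (p : ZdPlaquette 4)
    (U : LGConfig 4 G) : |plaquetteActionObs ρ p U| ≤ 2 * N := by
  have h := abs_plaquetteActionObs_sub_le ρ hρu p U
  have h2 : |plaquetteActionObs ρ p U| ≤ |plaquetteActionObs ρ p U - N| + |(N : ℝ)| := by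
    simpa using abs_add_le (plaquetteActionObs ρ p U - N) (N : ℝ)
  rw [Nat.abs_cast] at h2
  linarith

/-- **The lift of the action density is the torus plaquette term** at the projected plaquette (the plaquette terms of
the periodic lattice). [cite: MontvayMunster1994, §3.2.2 (3.65) and §3.2.6 (3.145)] -/
theorem plaquetteActionObs_finTorusLift {L T : ℕ} [NeZero L] [NeZero T] (p : ZdPlaquette 4)
    (V : FinTorusSite L L L T × Fin 4 → G) :
    plaquetteActionObs ρ p (finTorusLift L T V) =
      (N : ℝ) - (ρ (finTorusPlaquette V (finTorusProjSite L T p.1) p.2.1.1 p.2.1.2)).trace.re := by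
  simp only [plaquetteActionObs, plaquetteObs, plaquetteHolonomyZd_finTorusLift]

/-- The links of the plaquette `p = (y, i, j)` are based within sup-distance `1` of `y` (the plaquette's corners are
`y, y + eᵢ, y + eᵢ + eⱼ, y + eⱼ`). [cite: MontvayMunster1994, §3.2.2 (3.62)–(3.64)] -/
theorem floor_norm_sub_le_one_of_mem_plaquetteEdges {p : ZdPlaquette 4} {z : ZdEdge 4} (hz : z ∈ plaquetteEdges p) :
    ⌊‖z.1 - p.1‖⌋₊ ≤ 1 := by
  have h1 : ‖z.1 - p.1‖ ≤ 1 := by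
    simp only [plaquetteEdges, mem_insert, mem_singleton] at hz
    rcases hz with rfl | rfl | rfl | rfl
    · simp
    · simp [Pi.norm_single]
    · simp [Pi.norm_single]
    · simp
  calc ⌊‖z.1 - p.1‖⌋₊ ≤ ⌊(1 : ℝ)⌋₊ := Nat.floor_mono h1
    _ = 1 := by simp

end Plaquette

end Literature.MathematicalPhysics.QuantumFieldTheory

end
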